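import Mathlib

/-!
# Tier4/Line1/HaarModulus — the modulus of a continuous additive automorphism of a locally compact second countable
abelian group (Mathlib only)

Blind re-derivation cell `pub-hodge-repro`, Tier 4 (README §9–§10), seat t4-L2-p2 (gen 2), wall-breaker on the
cocompactness rung C5 of LINE L1 (t4-L1-p5's `I1c-rungs-sig.lean`, «the adelic modulus»).  Target tree path
`lean/Summits/Ventures/HodgeRepro/Tier4/Line1/HaarModulus.lean`.

For a locally compact, second countable abelian topological group `G` with a Haar measure `μ` and a continuous
additive automorphism `e : G ≃ₜ+ G`, the push-forward `map e μ` is again a Haar measure, hence (uniqueness,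
Mathlib `isAddLeftInvariant_eq_smul`) `map e μ = c • μ` for a unique scalar `c = modulus μ e : ℝ≥0`.  This file
records the bookkeeping: the scalar is characterised by `map e μ = c • μ` (`modulus_eq_of_map_eq_smul`), it does
not depend on the Haar measure (`modulus_eq_of_map_eq_smul'`), it is multiplicative (`modulus_trans`), positive,
equal to `1` when `e` preserves a set of finite positive measure (`modulus_eq_one_of_preimage_eq`), and equal to `1`
when its square is (`modulus_eq_one_of_sq`).  For a topological commutative ring the modulus of multiplication by a
unit (`modUnit`) is a monoid homomorphism `Rˣ →* ℝ≥0`.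

Nothing here asserts anything about the Hodge conjecture for CM abelian varieties, which is NOT proved (HC_CM is NOT
proved by anyone in this repository).
-/

set_option autoImplicit false

noncomputable section

namespace Summit.Ventures.HodgeRepro.Tier4.Line1

open MeasureTheory Measure Topology
open scoped ENNReal NNReal

section Modulus

variable {G : Type*} [AddCommGroup G] [TopologicalSpace G] [IsTopologicalAddGroup G]
  [LocallyCompactSpace G] [SecondCountableTopology G] [MeasurableSpace G] [BorelSpace G]
  (μ : Measure G) [μ.IsAddHaarMeasure]

/-- **The modulus** of a continuous additive automorphism `e` of `G` with respect to the Haar measure `μ`: the scalar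
`c` with `map e μ = c • μ` (Mathlib's `addHaarScalarFactor` of the Haar measure `map e μ` against `μ`). -/
def modulus (e : G ≃ₜ+ G) : ℝ≥0 :=
  haveI := e.isAddHaarMeasure_map μ
  addHaarScalarFactor (map e μ) μ

/-- `map e μ = modulus μ e • μ` (uniqueness of Haar measure on a second countable group). -/
theorem map_eq_modulus_smul (e : G ≃ₜ+ G) : map e μ = modulus μ e • μ := by
  haveI := e.isAddHaarMeasure_map μ
  exact isAddLeftInvariant_eq_smul (map e μ) μ

omit [IsTopologicalAddGroup G] [SecondCountableTopology G] [BorelSpace G] in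
/-- A compact set of finite positive Haar measure exists (a compact neighbourhood of `0`). -/
theorem exists_isCompact_measure_ne_zero_ne_top : ∃ K : Set G, IsCompact K ∧ μ K ≠ 0 ∧ μ K ≠ ⊤ := by
  obtain ⟨K, hK, hKn⟩ := exists_compact_mem_nhds (0 : G)
  exact ⟨K, hK, (measure_pos_of_nonempty_interior μ ⟨0, mem_interior_iff_mem_nhds.2 hKn⟩).ne',
    hK.measure_lt_top.ne⟩

omit [IsTopologicalAddGroup G] [SecondCountableTopology G] [BorelSpace G] in
/-- Two scalar multiples of a Haar measure coincide only if the scalars do. -/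
theorem nnreal_smul_eq_smul_iff {c d : ℝ≥0} (h : c • μ = d • μ) : c = d := by
  obtain ⟨K, -, h0, htop⟩ := exists_isCompact_measure_ne_zero_ne_top μ
  have hK := congrArg (fun ν : Measure G => ν K) h
  simp only [Measure.smul_apply, ENNReal.smul_def, smul_eq_mul] at hK
  exact_mod_cast (ENNReal.mul_left_inj h0 htop).1 hK

/-- The modulus is characterised by `map e μ = c • μ`. -/
theorem modulus_eq_of_map_eq_smul {e : G ≃ₜ+ G} {c : ℝ≥0} (h : map e μ = c • μ) : modulus μ e = c :=
  nnreal_smul_eq_smul_iff μ ((map_eq_modulus_smul μ e).symm.trans h)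

/-- The modulus does not depend on the Haar measure: `map e ν = c • ν` for SOME Haar measure `ν` determines it. -/
theorem modulus_eq_of_map_eq_smul' (ν : Measure G) [ν.IsAddHaarMeasure] {e : G ≃ₜ+ G} {c : ℝ≥0}
    (h : map e ν = c • ν) : modulus μ e = c := by
  apply modulus_eq_of_map_eq_smul
  have hμν : μ = addHaarScalarFactor μ ν • ν := isAddLeftInvariant_eq_smul μ ν
  rw [hμν, Measure.map_smul, h, smul_smul, smul_smul, mul_comm]

/-- The modulus is independent of the Haar measure. -/
theorem modulus_eq_modulus (ν : Measure G) [ν.IsAddHaarMeasure] (e : G ≃ₜ+ G) : modulus μ e = modulus ν e :=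
  modulus_eq_of_map_eq_smul' μ ν (map_eq_modulus_smul ν e)

omit [LocallyCompactSpace G] [SecondCountableTopology G] in
/-- The modulus is positive. -/
theorem modulus_pos (e : G ≃ₜ+ G) : 0 < modulus μ e := by
  haveI := e.isAddHaarMeasure_map μ
  exact addHaarScalarFactor_pos_of_isAddHaarMeasure (map e μ) μ

omit [LocallyCompactSpace G] [SecondCountableTopology G] in
/-- The modulus is non-zero. -/
theorem modulus_ne_zero (e : G ≃ₜ+ G) : modulus μ e ≠ 0 := (modulus_pos μ e).ne'

/-- The modulus of the identity is `1`. -/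
theorem modulus_refl : modulus μ (ContinuousAddEquiv.refl G) = 1 := by
  apply modulus_eq_of_map_eq_smul
  simp only [one_smul]
  exact Measure.map_id

/-- The modulus is multiplicative: `modulus (e.trans f) = modulus e * modulus f`. -/
theorem modulus_trans (e f : G ≃ₜ+ G) : modulus μ (e.trans f) = modulus μ e * modulus μ f := by
  apply modulus_eq_of_map_eq_smul
  have hcoe : ⇑(e.trans f) = ⇑f ∘ ⇑e := rfl
  have hf : Measurable (⇑f : G → G) := f.continuous.measurable
  have he : Measurable (⇑e : G → G) := e.continuous.measurable
  rw [hcoe, ← Measure.map_map hf he, map_eq_modulus_smul μ e,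
    Measure.map_smul, map_eq_modulus_smul μ f, smul_smul]

/-- `modulus e.symm * modulus e = 1`. -/
theorem modulus_symm_mul (e : G ≃ₜ+ G) : modulus μ e.symm * modulus μ e = 1 := by
  rw [← modulus_trans]
  have : e.symm.trans e = ContinuousAddEquiv.refl G := by
    ext x
    exact e.apply_symm_apply x
  rw [this, modulus_refl]

/-- The modulus of the inverse automorphism. -/
theorem modulus_symm (e : G ≃ₜ+ G) : modulus μ e.symm = (modulus μ e)⁻¹ := by
  have h := modulus_symm_mul μ e
  exact eq_inv_of_mul_eq_one_left h

/-- If `e` preserves a set `K` of finite positive measure (`e ⁻¹' K = K`), then `modulus e = 1`. -/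
theorem modulus_eq_one_of_preimage_eq (e : G ≃ₜ+ G) {K : Set G} (hK : ⇑e ⁻¹' K = K) (h0 : μ K ≠ 0)
    (htop : μ K ≠ ⊤) : modulus μ e = 1 := by
  have h1 : (map e μ) K = μ K := by
    have := MeasurableEquiv.map_apply (μ := μ) e.toHomeomorph.toMeasurableEquiv K
    have this' : (map (⇑e) μ) K = μ (⇑e ⁻¹' K) := this
    rw [this', hK]
  have h2 := congrArg (fun ν : Measure G => ν K) (map_eq_modulus_smul μ e)
  simp only [Measure.smul_apply, ENNReal.smul_def, smul_eq_mul] at h2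
  rw [h1] at h2
  have h3 : ((modulus μ e : ℝ≥0) : ℝ≥0∞) * μ K = 1 * μ K := by rw [one_mul]; exact h2.symm
  exact_mod_cast (ENNReal.mul_left_inj h0 htop).1 h3

/-- If `e` preserves a set `K` of finite positive measure (`e '' K = K`), then `modulus e = 1`. -/
theorem modulus_eq_one_of_image_eq (e : G ≃ₜ+ G) {K : Set G} (hK : ⇑e '' K = K) (h0 : μ K ≠ 0)
    (htop : μ K ≠ ⊤) : modulus μ e = 1 := by
  apply modulus_eq_one_of_preimage_eq μ e _ h0 htop
  have : ⇑e ⁻¹' K = ⇑e.symm '' K := by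
    ext x
    constructor
    · intro hx
      exact ⟨e x, hx, e.symm_apply_apply x⟩
    · rintro ⟨y, hy, rfl⟩
      simpa using hy
  rw [this]
  conv_lhs => rw [← hK]
  ext x
  constructor
  · rintro ⟨y, ⟨z, hz, rfl⟩, rfl⟩
    simpa using hz
  · intro hx
    exact ⟨e x, ⟨x, hx, rfl⟩, e.symm_apply_apply x⟩

omit [LocallyCompactSpace G] [SecondCountableTopology G] in
/-- A modulus whose square is `1` is `1`. -/
theorem modulus_eq_one_of_sq (e : G ≃ₜ+ G) (h : modulus μ e ^ 2 = 1) : modulus μ e = 1 :=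
  (pow_eq_one_iff_of_nonneg (modulus_pos μ e).le two_ne_zero).1 h

/-- The measure of the image of a set: `μ (e '' S) = (modulus μ e)⁻¹ • μ S` (for EVERY set `S`). -/
theorem measure_image (e : G ≃ₜ+ G) (S : Set G) : μ (⇑e '' S) = (modulus μ e)⁻¹ • μ S := by
  have h1 : ⇑e '' S = ⇑e.symm ⁻¹' S := by
    ext x
    constructor
    · rintro ⟨y, hy, rfl⟩
      simpa using hy
    · intro hx
      exact ⟨e.symm x, hx, e.apply_symm_apply x⟩
  have h2 := MeasurableEquiv.map_apply (μ := μ) e.symm.toHomeomorph.toMeasurableEquiv S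
  have h2' : (map (⇑e.symm) μ) S = μ (⇑e.symm ⁻¹' S) := h2
  have h3 := congrArg (fun ν : Measure G => ν S) (map_eq_modulus_smul μ e.symm)
  simp only [Measure.smul_apply] at h3
  rw [h1, ← modulus_symm]
  exact h2'.symm.trans h3

/-- If `modulus e = 1` then `e` preserves the measure of every set. -/
theorem measure_image_eq_of_modulus_eq_one (e : G ≃ₜ+ G) (h : modulus μ e = 1) (S : Set G) :
    μ (⇑e '' S) = μ S := by
  rw [measure_image μ e S, h, inv_one, one_smul]

/-- If `modulus e = 1` then `map e μ = μ`. -/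
theorem map_eq_of_modulus_eq_one (e : G ≃ₜ+ G) (h : modulus μ e = 1) : map e μ = μ := by
  rw [map_eq_modulus_smul μ e, h, one_smul]

end Modulus

section Ring

variable {R : Type*} [CommRing R] [TopologicalSpace R] [IsTopologicalRing R]
  [LocallyCompactSpace R] [SecondCountableTopology R] [MeasurableSpace R] [BorelSpace R]

/-- Multiplication by a unit `u` on the right, as a continuous additive automorphism of the ring. -/
def mulRightEquiv (u : Rˣ) : R ≃ₜ+ R where
  toFun x := x * u
  invFun x := x * ↑u⁻¹
  left_inv x := by simp [mul_assoc]
  right_inv x := by simp [mul_assoc]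
  map_add' x y := add_mul x y u
  continuous_toFun := continuous_mul_const (u : R)
  continuous_invFun := continuous_mul_const ((u⁻¹ : Rˣ) : R)

omit [LocallyCompactSpace R] [SecondCountableTopology R] [MeasurableSpace R] [BorelSpace R] in
/-- `mulRightEquiv u x = x * u`. -/
@[simp]
theorem mulRightEquiv_apply (u : Rˣ) (x : R) : mulRightEquiv u x = x * u := rfl

omit [LocallyCompactSpace R] [SecondCountableTopology R] [MeasurableSpace R] [BorelSpace R] in
/-- Multiplication by a product is the composite of the multiplications. -/
theorem mulRightEquiv_mul (u v : Rˣ) : mulRightEquiv (u * v) = (mulRightEquiv u).trans (mulRightEquiv v) := by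
  ext x
  simp [mul_assoc]

omit [LocallyCompactSpace R] [SecondCountableTopology R] [MeasurableSpace R] [BorelSpace R] in
/-- Multiplication by `1` is the identity. -/
theorem mulRightEquiv_one : mulRightEquiv (1 : Rˣ) = ContinuousAddEquiv.refl R := by
  ext x
  simp

variable (ν : Measure R) [ν.IsAddHaarMeasure]

/-- **The modulus of a unit** of a locally compact second countable topological commutative ring: the modulus of
multiplication by it. -/
def modUnit (u : Rˣ) : ℝ≥0 := modulus ν (mulRightEquiv u)

/-- The modulus of units is multiplicative. -/
theorem modUnit_mul (u v : Rˣ) : modUnit ν (u * v) = modUnit ν u * modUnit ν v := by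
  unfold modUnit
  rw [mulRightEquiv_mul, modulus_trans]

/-- The modulus of `1` is `1`. -/
theorem modUnit_one : modUnit ν (1 : Rˣ) = 1 := by
  unfold modUnit
  rw [mulRightEquiv_one, modulus_refl]

/-- The modulus of units as a monoid homomorphism `Rˣ →* ℝ≥0`. -/
def modUnitHom : Rˣ →* ℝ≥0 where
  toFun := modUnit ν
  map_one' := modUnit_one ν
  map_mul' := modUnit_mul ν

/-- The modulus of a power. -/
theorem modUnit_pow (u : Rˣ) (n : ℕ) : modUnit ν (u ^ n) = modUnit ν u ^ n :=
  map_pow (modUnitHom ν) u n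

/-- A unit whose square is `1` has modulus `1`. -/
theorem modUnit_eq_one_of_sq_eq_one (u : Rˣ) (hu : u ^ 2 = 1) : modUnit ν u = 1 := by
  apply modulus_eq_one_of_sq
  show modUnit ν u ^ 2 = 1
  rw [← modUnit_pow, hu, modUnit_one]

/-- The modulus of a unit does not depend on the Haar measure. -/
theorem modUnit_eq_modUnit (ν' : Measure R) [ν'.IsAddHaarMeasure] (u : Rˣ) : modUnit ν u = modUnit ν' u :=
  modulus_eq_modulus ν ν' _

end Ring

end Summit.Ventures.HodgeRepro.Tier4.Line1

end
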